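import Summits.QuantumFields.YangMills.Theses.GronwallGap

/-!
# Birth skeleton (BC3) for crux `AnalyticDetour` (stmt-QuantumFields-8801) — `Lines/birth.lean`

Registrar: `planner-skel-stmt-QuantumFields-8801-0` (skeleton-register one-shot; route
`route-QuantumFields-GronwallGap`, sub-problem `YangMills`, re-audit bin REPAIRABLE), 2026-08-17.

Crux (route file `Theses/GronwallGap.lean`, decl
`Summit.QuantumFields.YangMills.Theses.GronwallGap.AnalyticDetour`, card J0): for every compact simple
`G` and every faithful unitary lattice representation `r` there are a locally finite `E ⊂ [0,∞)` and
`β₁ > 0` such that for every `β > 0`, `β ∉ E`, and every start `βs ∈ (0, β₁)` there is an ADMISSIBLE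
single-plaquette weight path `w : [0,1] → (G → ℝ)` (`Adm`: continuous, positive, symmetric class
functions of positive type, `s ↦ log w s` Lipschitz in sup norm) with Gateaux-analytic torus pressure
at every `s` (`AnP`), from `w 0 = exp(βs·Re tr r)` to `w 1 = exp(β·Re tr r)`.

## The cut: WINDOW ⊕ ANCHORED DETOUR, glued by path concatenation

The crux quantifies the START of the path universally over the whole strong-coupling window
`(0, β₁)` and the END universally over `(0,∞) ∖ E`.  Its two mechanisms are different and live at
the two ends, so the skeleton cuts between them and glues by CONCATENATION of admissible analytic
paths (reparametrise `[0,½] ∪ [½,1]`; the Lipschitz constant of `log w` becomes `2(|Λ₁|+|Λ₂|)`,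
the junction is handled by the triangle inequality through the common point) — a real proof, below.

* `stub_strongCouplingWindow` — **the window is internally connected** (route header TWO-LAYER PLAN:
  "GeneralWeightOS78"): for every `r` there is `β₁ > 0` such that ANY two Wilson points
  `βa, βb ∈ (0, β₁)` are joined by an admissible path with analytic pressure at every parameter.
  Expected witness: the straight Wilson segment; content = (i) the thermodynamic limit of the torus
  pressure for continuous positive class-function plaquette weights along ALL `L` (refuter note (a) on
  the item: standard, absent from the tree), (ii) analyticity in every central direction inside the
  Osterwalder–Seiler high-temperature window by the convergent polymer expansion for GENERAL weights
  close to Haar (OS78 Thm 3.5-type; tree has the Wilson weight only), (iii) admissibility of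
  `exp(β Re tr r)` (positive type by the Schur product theorem, `Re tr ρ(x⁻¹y)` a Gram kernel).
  Size L.  Why it might fail: only through (i) for wild continuous class weights at large `|t|`
  (existence of the limit along all `L`, not a subsequence) — believed routine (free/periodic
  comparison), but unproved here.
* `stub_anchoredDetour` — **the open core** (route header: "WilsonAxisAnalytic" + "EndpointDetour"):
  for every `r` there is a locally finite `E` such that from anchors ARBITRARILY DEEP in strong
  coupling (`∀ b > 0, ∃ βa ∈ (0, b)`) every Wilson point `β > 0`, `β ∉ E` is reached by an admissible
  analytic path.  For crossover-only groups (SU(2), SU(3)) the Wilson segment (contains: no bulk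
  transition on the Wilson axis off `E`); for groups with an on-axis first-order wall (SU(N ≥ 5),
  SO(3), large reps) a detour around the wall's endpoint inside the positive-type cone.  Size XL /
  open.  Why it might fail: verbatim the crux's (every positive-type single-plaquette family of
  SU(N ≥ 5) may meet a bulk singularity; positivity of `exp(β_f Re tr_f + β_A Re tr_A)`, `β_A < 0`,
  unproved).  It is STRICTLY WEAKER than the crux in the start point (existential anchors, no
  uniformity over `(0, β₁)`), and does not give the crux without the window stub.
* `AnalyticDetour_of : stub₁-sig → stub₂-sig → AnalyticDetour` — sorry-free: take `β₁` from the
  window, `E` and an anchor `βa ∈ (0, β₁)` from the detour; for `β ∉ E`, `βs ∈ (0, β₁)` concatenate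
  the window path `βs ⇝ βa` with the detour `βa ⇝ β` (`concat`, `concat_forall`,
  `concat_log_lipschitz`).  `AnalyticDetour_skeleton : AnalyticDetour` instantiates it with the two
  stubs BY NAME.

Neither stub is cheaply the crux or the summit: BC3 probes `stub → AnalyticDetour` and
`stub → YangMills` by `first | exact? | simpa | aesop` fail for both (registrar folder
`bc/birth_probes.lean`; outputs quoted in `Lines/birth.md`).  Disproof used: none on file for this crux
(`ledger crux ls stmt-QuantumFields-8801`: no workfiles before this one; negatives index of the summit
has no statement about admissible weight paths).

`lean check`: rc 0; sorries = 2 = stubs (`stub_strongCouplingWindow`, `stub_anchoredDetour`), zero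
elsewhere.  Namespace `Summit.QuantumFields.YangMills.Cruxes.AnalyticDetour.Birth`.
-/

set_option autoImplicit false

noncomputable section

namespace Summit.QuantumFields.YangMills.Cruxes.AnalyticDetour.Birth

open scoped BigOperators
open Summit.QuantumFields.YangMills.Theses.GronwallGap (AnalyticDetour)

/-! ## § Stubs — the ONLY two `sorry`s of the file -/

/-- **Stub 1 `stub_strongCouplingWindow` — the strong-coupling window is internally connected by
admissible analytic paths.**  For every compact simple `G` and every `r` there is `β₁ > 0` such that
any two Wilson points `βa, βb ∈ (0, β₁)` are joined by an admissible weight path (`Adm`) whose torus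
pressure is Gateaux-analytic in every continuous class-function direction at every parameter
(`AnP`), from `exp(βa Re tr r)` to `exp(βb Re tr r)`.  (General-weight Osterwalder–Seiler window:
thermodynamic limit of the pressure + high-temperature analyticity + Schur-product admissibility of
the Wilson weights; the straight segment is the expected witness.) -/
theorem stub_strongCouplingWindow :
    ∀ (G : Type) [Group G] [TopologicalSpace G] [IsTopologicalGroup G] [CompactSpace G],
      Literature.MathematicalPhysics.QuantumFieldTheory.IsCompactSimpleLieGroup G → letI : MeasurableSpace G := borel G; haveI : BorelSpace G := ⟨rfl⟩;
      let Pseq : (G → ℝ) → ℕ → ℝ := fun v L => (((L + 1 : ℕ) : ℝ) ^ 4)⁻¹ * Real.log (((MeasureTheory.Measure.pi fun _ : Literature.MathematicalPhysics.QuantumFieldTheory.Edge 4 (L + 1) => Literature.MathematicalPhysics.QuantumFieldTheory.haarProbability G).withDensity (fun U : Literature.MathematicalPhysics.QuantumFieldTheory.GaugeConfig 4 (L + 1) G => ENNReal.ofReal (Literature.MathematicalPhysics.QuantumLattice.groupHeatKernelWeight (fun _ : ℝ => v) 0 U))) Set.univ).toReal;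
      let AnP : (G → ℝ) → Prop := fun v => ∀ φ : G → ℝ, Continuous φ → (∀ g h : G, φ (h * g * h⁻¹) = φ g) → ∃ p : ℝ → ℝ, (∀ t : ℝ, Filter.Tendsto (fun L : ℕ => Pseq (fun g => v g * Real.exp (t * φ g)) L) Filter.atTop (nhds (p t))) ∧ AnalyticAt ℝ p 0;
      let Adm : (ℝ → G → ℝ) → Prop := fun w => (∀ s ∈ Set.Icc (0 : ℝ) 1, Continuous (w s) ∧ (∀ g : G, 0 < w s g) ∧ (∀ g h : G, w s (h * g * h⁻¹) = w s g) ∧ (∀ g : G, w s g⁻¹ = w s g) ∧ (∀ (n : ℕ) (x : Fin n → G) (c : Fin n → ℂ), 0 ≤ (∑ i, ∑ j, (starRingEnd ℂ) (c i) * c j * ((w s ((x i)⁻¹ * x j) : ℝ) : ℂ)).re)) ∧ ∃ Λ : ℝ, ∀ s ∈ Set.Icc (0 : ℝ) 1, ∀ s' ∈ Set.Icc (0 : ℝ) 1, ∀ g : G, |Real.log (w s g) - Real.log (w s' g)| ≤ Λ * |s - s'|;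
      ∀ r : Literature.MathematicalPhysics.QuantumFieldTheory.LatticeRep G, ∃ β₁ : ℝ, 0 < β₁ ∧ ∀ βa ∈ Set.Ioo (0 : ℝ) β₁, ∀ βb ∈ Set.Ioo (0 : ℝ) β₁, ∃ w : ℝ → G → ℝ, Adm w ∧ (∀ s ∈ Set.Icc (0 : ℝ) 1, AnP (w s)) ∧ w 0 = (fun g => Real.exp (βa * (r.ρ g).trace.re)) ∧ w 1 = (fun g => Real.exp (βb * (r.ρ g).trace.re)) := by
  sorry

/-- **Stub 2 `stub_anchoredDetour` — the open core: off a locally finite `E`, every Wilson point is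
reachable from anchors arbitrarily deep in strong coupling.**  For every compact simple `G` and every
`r` there is a locally finite `E ⊂ [0,∞)` such that for every `b > 0` some anchor `βa ∈ (0, b)` is
joined to EVERY `β > 0`, `β ∉ E` by an admissible weight path with Gateaux-analytic pressure at every
parameter (Wilson segment for crossover-only groups; a positive-type detour around the endpoint of
the first-order wall otherwise; `E` = the on-axis coexistence points). -/
theorem stub_anchoredDetour :
    ∀ (G : Type) [Group G] [TopologicalSpace G] [IsTopologicalGroup G] [CompactSpace G],
      Literature.MathematicalPhysics.QuantumFieldTheory.IsCompactSimpleLieGroup G → letI : MeasurableSpace G := borel G; haveI : BorelSpace G := ⟨rfl⟩;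
      let Pseq : (G → ℝ) → ℕ → ℝ := fun v L => (((L + 1 : ℕ) : ℝ) ^ 4)⁻¹ * Real.log (((MeasureTheory.Measure.pi fun _ : Literature.MathematicalPhysics.QuantumFieldTheory.Edge 4 (L + 1) => Literature.MathematicalPhysics.QuantumFieldTheory.haarProbability G).withDensity (fun U : Literature.MathematicalPhysics.QuantumFieldTheory.GaugeConfig 4 (L + 1) G => ENNReal.ofReal (Literature.MathematicalPhysics.QuantumLattice.groupHeatKernelWeight (fun _ : ℝ => v) 0 U))) Set.univ).toReal;
      let AnP : (G → ℝ) → Prop := fun v => ∀ φ : G → ℝ, Continuous φ → (∀ g h : G, φ (h * g * h⁻¹) = φ g) → ∃ p : ℝ → ℝ, (∀ t : ℝ, Filter.Tendsto (fun L : ℕ => Pseq (fun g => v g * Real.exp (t * φ g)) L) Filter.atTop (nhds (p t))) ∧ AnalyticAt ℝ p 0;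
      let Adm : (ℝ → G → ℝ) → Prop := fun w => (∀ s ∈ Set.Icc (0 : ℝ) 1, Continuous (w s) ∧ (∀ g : G, 0 < w s g) ∧ (∀ g h : G, w s (h * g * h⁻¹) = w s g) ∧ (∀ g : G, w s g⁻¹ = w s g) ∧ (∀ (n : ℕ) (x : Fin n → G) (c : Fin n → ℂ), 0 ≤ (∑ i, ∑ j, (starRingEnd ℂ) (c i) * c j * ((w s ((x i)⁻¹ * x j) : ℝ) : ℂ)).re)) ∧ ∃ Λ : ℝ, ∀ s ∈ Set.Icc (0 : ℝ) 1, ∀ s' ∈ Set.Icc (0 : ℝ) 1, ∀ g : G, |Real.log (w s g) - Real.log (w s' g)| ≤ Λ * |s - s'|;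
      ∀ r : Literature.MathematicalPhysics.QuantumFieldTheory.LatticeRep G, ∃ E : Set ℝ, (∀ b : ℝ, (E ∩ Set.Icc 0 b).Finite) ∧ ∀ b : ℝ, 0 < b → ∃ βa ∈ Set.Ioo (0 : ℝ) b, ∀ β : ℝ, 0 < β → β ∉ E → ∃ w : ℝ → G → ℝ, Adm w ∧ (∀ s ∈ Set.Icc (0 : ℝ) 1, AnP (w s)) ∧ w 0 = (fun g => Real.exp (βa * (r.ρ g).trace.re)) ∧ w 1 = (fun g => Real.exp (β * (r.ρ g).trace.re)) := by
  sorry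

/-! ## § Glue — concatenation of admissible analytic paths (sorry-free) -/

/-- Concatenation of two weight paths on `[0,1]`: run `w₁` at double speed on `[0,½]`, then `w₂`. -/
def concat {G : Type} (w₁ w₂ : ℝ → G → ℝ) (s : ℝ) : G → ℝ :=
  if s ≤ 1 / 2 then w₁ (2 * s) else w₂ (2 * s - 1)

theorem concat_zero {G : Type} (w₁ w₂ : ℝ → G → ℝ) : concat w₁ w₂ 0 = w₁ 0 := by
  norm_num [concat]

theorem concat_one {G : Type} (w₁ w₂ : ℝ → G → ℝ) : concat w₁ w₂ 1 = w₂ 1 := by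
  norm_num [concat]

/-- Pointwise-in-`s` properties transfer to the concatenation. -/
theorem concat_forall {G : Type} (Q : (G → ℝ) → Prop) {w₁ w₂ : ℝ → G → ℝ}
    (hQ₁ : ∀ s ∈ Set.Icc (0 : ℝ) 1, Q (w₁ s)) (hQ₂ : ∀ s ∈ Set.Icc (0 : ℝ) 1, Q (w₂ s)) :
    ∀ s ∈ Set.Icc (0 : ℝ) 1, Q (concat w₁ w₂ s) := by
  intro s hs
  obtain ⟨hs0, hs1⟩ := hs
  by_cases h : s ≤ 1 / 2
  · rw [concat, if_pos h]
    exact hQ₁ (2 * s) ⟨by linarith, by linarith⟩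
  · rw [concat, if_neg h]
    rw [not_le] at h
    exact hQ₂ (2 * s - 1) ⟨by linarith, by linarith⟩

/-- Log-Lipschitz control of the concatenation, ordered parameters. -/
theorem concat_log_lipschitz_of_le {G : Type} {w₁ w₂ : ℝ → G → ℝ} {Λ₁ Λ₂ : ℝ}
    (hL₁ : ∀ s ∈ Set.Icc (0 : ℝ) 1, ∀ s' ∈ Set.Icc (0 : ℝ) 1, ∀ g : G,
      |Real.log (w₁ s g) - Real.log (w₁ s' g)| ≤ Λ₁ * |s - s'|)
    (hL₂ : ∀ s ∈ Set.Icc (0 : ℝ) 1, ∀ s' ∈ Set.Icc (0 : ℝ) 1, ∀ g : G,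
      |Real.log (w₂ s g) - Real.log (w₂ s' g)| ≤ Λ₂ * |s - s'|)
    (hjoin : w₁ 1 = w₂ 0) {s s' : ℝ} (hss' : s ≤ s')
    (hs : s ∈ Set.Icc (0 : ℝ) 1) (hs' : s' ∈ Set.Icc (0 : ℝ) 1) (g : G) :
    |Real.log (concat w₁ w₂ s g) - Real.log (concat w₁ w₂ s' g)| ≤
      2 * (|Λ₁| + |Λ₂|) * (s' - s) := by
  obtain ⟨hs0, hs1⟩ := hs
  obtain ⟨hs0', hs1'⟩ := hs'
  have hA₁ : 0 ≤ |Λ₁| := abs_nonneg _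
  have hA₂ : 0 ≤ |Λ₂| := abs_nonneg _
  have hΛ₁ : Λ₁ ≤ |Λ₁| := le_abs_self _
  have hΛ₂ : Λ₂ ≤ |Λ₂| := le_abs_self _
  by_cases h' : s' ≤ 1 / 2
  · -- both parameters in the first half
    have h : s ≤ 1 / 2 := le_trans hss' h'
    simp only [concat, if_pos h, if_pos h']
    have key := hL₁ (2 * s) ⟨by linarith, by linarith⟩ (2 * s') ⟨by linarith, by linarith⟩ g
    have e : |2 * s - 2 * s'| = 2 * (s' - s) := by
      rw [abs_of_nonpos (by linarith)]; ring
    rw [e] at key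
    have m : Λ₁ * (2 * (s' - s)) ≤ |Λ₁| * (2 * (s' - s)) :=
      mul_le_mul_of_nonneg_right hΛ₁ (by linarith)
    have n : 0 ≤ |Λ₂| * (s' - s) := mul_nonneg hA₂ (by linarith)
    linarith
  · rw [not_le] at h'
    by_cases h : s ≤ 1 / 2
    · -- `s` in the first half, `s'` in the second: go through the junction `w₁ 1 = w₂ 0`
      simp only [concat, if_pos h, if_neg (not_le.mpr h')]
      have k1 := hL₁ (2 * s) ⟨by linarith, by linarith⟩ 1 ⟨by norm_num, by norm_num⟩ g
      have k2 := hL₂ 0 ⟨le_rfl, by norm_num⟩ (2 * s' - 1) ⟨by linarith, by linarith⟩ g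
      have e1 : |2 * s - 1| = 1 - 2 * s := by
        rw [abs_of_nonpos (by linarith)]; ring
      have e2 : |(0 : ℝ) - (2 * s' - 1)| = 2 * s' - 1 := by
        rw [abs_of_nonpos (by linarith)]; ring
      rw [e1] at k1
      rw [e2] at k2
      have hj : w₁ 1 g = w₂ 0 g := by rw [hjoin]
      rw [hj] at k1
      have tri := abs_sub_le (Real.log (w₁ (2 * s) g)) (Real.log (w₂ 0 g))
        (Real.log (w₂ (2 * s' - 1) g))
      have m1 : Λ₁ * (1 - 2 * s) ≤ |Λ₁| * (1 - 2 * s) :=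
        mul_le_mul_of_nonneg_right hΛ₁ (by linarith)
      have m2 : Λ₂ * (2 * s' - 1) ≤ |Λ₂| * (2 * s' - 1) :=
        mul_le_mul_of_nonneg_right hΛ₂ (by linarith)
      have n1 : 0 ≤ |Λ₁| * (2 * s' - 1) := mul_nonneg hA₁ (by linarith)
      have n2 : 0 ≤ |Λ₂| * (1 - 2 * s) := mul_nonneg hA₂ (by linarith)
      linarith
    · -- both parameters in the second half
      rw [not_le] at h
      simp only [concat, if_neg (not_le.mpr h), if_neg (not_le.mpr h')]
      have key := hL₂ (2 * s - 1) ⟨by linarith, by linarith⟩ (2 * s' - 1)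
        ⟨by linarith, by linarith⟩ g
      have e : |2 * s - 1 - (2 * s' - 1)| = 2 * (s' - s) := by
        rw [abs_of_nonpos (by linarith)]; ring
      rw [e] at key
      have m : Λ₂ * (2 * (s' - s)) ≤ |Λ₂| * (2 * (s' - s)) :=
        mul_le_mul_of_nonneg_right hΛ₂ (by linarith)
      have n : 0 ≤ |Λ₁| * (s' - s) := mul_nonneg hA₁ (by linarith)
      linarith

/-- Log-Lipschitz control of the concatenation. -/
theorem concat_log_lipschitz {G : Type} {w₁ w₂ : ℝ → G → ℝ} {Λ₁ Λ₂ : ℝ}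
    (hL₁ : ∀ s ∈ Set.Icc (0 : ℝ) 1, ∀ s' ∈ Set.Icc (0 : ℝ) 1, ∀ g : G,
      |Real.log (w₁ s g) - Real.log (w₁ s' g)| ≤ Λ₁ * |s - s'|)
    (hL₂ : ∀ s ∈ Set.Icc (0 : ℝ) 1, ∀ s' ∈ Set.Icc (0 : ℝ) 1, ∀ g : G,
      |Real.log (w₂ s g) - Real.log (w₂ s' g)| ≤ Λ₂ * |s - s'|)
    (hjoin : w₁ 1 = w₂ 0) :
    ∀ s ∈ Set.Icc (0 : ℝ) 1, ∀ s' ∈ Set.Icc (0 : ℝ) 1, ∀ g : G,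
      |Real.log (concat w₁ w₂ s g) - Real.log (concat w₁ w₂ s' g)| ≤
        2 * (|Λ₁| + |Λ₂|) * |s - s'| := by
  intro s hs s' hs' g
  rcases le_total s s' with hle | hle
  · rw [abs_of_nonpos (sub_nonpos.mpr hle), neg_sub]
    exact concat_log_lipschitz_of_le hL₁ hL₂ hjoin hle hs hs' g
  · rw [abs_of_nonneg (sub_nonneg.mpr hle), abs_sub_comm]
    exact concat_log_lipschitz_of_le hL₁ hL₂ hjoin hle hs' hs g

/-! ## § Assembly — sorry-free; concludes the route decl BY NAME -/

/-- **Composition (real proof).**  The window stub's statement and the anchored-detour stub's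
statement imply the crux `AnalyticDetour` BY NAME: `β₁` from the window; `E` and an anchor
`βa ∈ (0, β₁)` from the detour (`b := β₁`); for `β > 0`, `β ∉ E`, `βs ∈ (0, β₁)` the witness is the
concatenation of the window path `βs ⇝ βa` with the detour `βa ⇝ β` — admissible (`concat_forall`
for the five pointwise conditions, `concat_log_lipschitz` with constant `2(|Λ₁|+|Λ₂|)` for the
Lipschitz clause, junction `w₁ 1 = exp(βa Re tr r) = w₂ 0`), analytic at every parameter
(`concat_forall` for `AnP`), with the right endpoints (`concat_zero`, `concat_one`). -/
theorem AnalyticDetour_of :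
    (∀ (G : Type) [Group G] [TopologicalSpace G] [IsTopologicalGroup G] [CompactSpace G],
        Literature.MathematicalPhysics.QuantumFieldTheory.IsCompactSimpleLieGroup G → letI : MeasurableSpace G := borel G; haveI : BorelSpace G := ⟨rfl⟩;
        let Pseq : (G → ℝ) → ℕ → ℝ := fun v L => (((L + 1 : ℕ) : ℝ) ^ 4)⁻¹ * Real.log (((MeasureTheory.Measure.pi fun _ : Literature.MathematicalPhysics.QuantumFieldTheory.Edge 4 (L + 1) => Literature.MathematicalPhysics.QuantumFieldTheory.haarProbability G).withDensity (fun U : Literature.MathematicalPhysics.QuantumFieldTheory.GaugeConfig 4 (L + 1) G => ENNReal.ofReal (Literature.MathematicalPhysics.QuantumLattice.groupHeatKernelWeight (fun _ : ℝ => v) 0 U))) Set.univ).toReal;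
        let AnP : (G → ℝ) → Prop := fun v => ∀ φ : G → ℝ, Continuous φ → (∀ g h : G, φ (h * g * h⁻¹) = φ g) → ∃ p : ℝ → ℝ, (∀ t : ℝ, Filter.Tendsto (fun L : ℕ => Pseq (fun g => v g * Real.exp (t * φ g)) L) Filter.atTop (nhds (p t))) ∧ AnalyticAt ℝ p 0;
        let Adm : (ℝ → G → ℝ) → Prop := fun w => (∀ s ∈ Set.Icc (0 : ℝ) 1, Continuous (w s) ∧ (∀ g : G, 0 < w s g) ∧ (∀ g h : G, w s (h * g * h⁻¹) = w s g) ∧ (∀ g : G, w s g⁻¹ = w s g) ∧ (∀ (n : ℕ) (x : Fin n → G) (c : Fin n → ℂ), 0 ≤ (∑ i, ∑ j, (starRingEnd ℂ) (c i) * c j * ((w s ((x i)⁻¹ * x j) : ℝ) : ℂ)).re)) ∧ ∃ Λ : ℝ, ∀ s ∈ Set.Icc (0 : ℝ) 1, ∀ s' ∈ Set.Icc (0 : ℝ) 1, ∀ g : G, |Real.log (w s g) - Real.log (w s' g)| ≤ Λ * |s - s'|;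
        ∀ r : Literature.MathematicalPhysics.QuantumFieldTheory.LatticeRep G, ∃ β₁ : ℝ, 0 < β₁ ∧ ∀ βa ∈ Set.Ioo (0 : ℝ) β₁, ∀ βb ∈ Set.Ioo (0 : ℝ) β₁, ∃ w : ℝ → G → ℝ, Adm w ∧ (∀ s ∈ Set.Icc (0 : ℝ) 1, AnP (w s)) ∧ w 0 = (fun g => Real.exp (βa * (r.ρ g).trace.re)) ∧ w 1 = (fun g => Real.exp (βb * (r.ρ g).trace.re))) →
    (∀ (G : Type) [Group G] [TopologicalSpace G] [IsTopologicalGroup G] [CompactSpace G],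
        Literature.MathematicalPhysics.QuantumFieldTheory.IsCompactSimpleLieGroup G → letI : MeasurableSpace G := borel G; haveI : BorelSpace G := ⟨rfl⟩;
        let Pseq : (G → ℝ) → ℕ → ℝ := fun v L => (((L + 1 : ℕ) : ℝ) ^ 4)⁻¹ * Real.log (((MeasureTheory.Measure.pi fun _ : Literature.MathematicalPhysics.QuantumFieldTheory.Edge 4 (L + 1) => Literature.MathematicalPhysics.QuantumFieldTheory.haarProbability G).withDensity (fun U : Literature.MathematicalPhysics.QuantumFieldTheory.GaugeConfig 4 (L + 1) G => ENNReal.ofReal (Literature.MathematicalPhysics.QuantumLattice.groupHeatKernelWeight (fun _ : ℝ => v) 0 U))) Set.univ).toReal;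
        let AnP : (G → ℝ) → Prop := fun v => ∀ φ : G → ℝ, Continuous φ → (∀ g h : G, φ (h * g * h⁻¹) = φ g) → ∃ p : ℝ → ℝ, (∀ t : ℝ, Filter.Tendsto (fun L : ℕ => Pseq (fun g => v g * Real.exp (t * φ g)) L) Filter.atTop (nhds (p t))) ∧ AnalyticAt ℝ p 0;
        let Adm : (ℝ → G → ℝ) → Prop := fun w => (∀ s ∈ Set.Icc (0 : ℝ) 1, Continuous (w s) ∧ (∀ g : G, 0 < w s g) ∧ (∀ g h : G, w s (h * g * h⁻¹) = w s g) ∧ (∀ g : G, w s g⁻¹ = w s g) ∧ (∀ (n : ℕ) (x : Fin n → G) (c : Fin n → ℂ), 0 ≤ (∑ i, ∑ j, (starRingEnd ℂ) (c i) * c j * ((w s ((x i)⁻¹ * x j) : ℝ) : ℂ)).re)) ∧ ∃ Λ : ℝ, ∀ s ∈ Set.Icc (0 : ℝ) 1, ∀ s' ∈ Set.Icc (0 : ℝ) 1, ∀ g : G, |Real.log (w s g) - Real.log (w s' g)| ≤ Λ * |s - s'|;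
        ∀ r : Literature.MathematicalPhysics.QuantumFieldTheory.LatticeRep G, ∃ E : Set ℝ, (∀ b : ℝ, (E ∩ Set.Icc 0 b).Finite) ∧ ∀ b : ℝ, 0 < b → ∃ βa ∈ Set.Ioo (0 : ℝ) b, ∀ β : ℝ, 0 < β → β ∉ E → ∃ w : ℝ → G → ℝ, Adm w ∧ (∀ s ∈ Set.Icc (0 : ℝ) 1, AnP (w s)) ∧ w 0 = (fun g => Real.exp (βa * (r.ρ g).trace.re)) ∧ w 1 = (fun g => Real.exp (β * (r.ρ g).trace.re))) →
    AnalyticDetour := by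
  intro h1 h2 G i1 i2 i3 i4 hG Pseq AnP Adm r
  obtain ⟨β₁, hβ₁, hwin⟩ := h1 G hG r
  obtain ⟨E, hE, hanch⟩ := h2 G hG r
  obtain ⟨βa, hβa, hdet⟩ := hanch β₁ hβ₁
  refine ⟨E, hE, β₁, hβ₁, fun β hβ hβE βs hβs => ?_⟩
  obtain ⟨w₁, hAdm₁, hAn₁, hw₁0, hw₁1⟩ := hwin βs hβs βa hβa
  obtain ⟨w₂, hAdm₂, hAn₂, hw₂0, hw₂1⟩ := hdet β hβ hβE
  have hjoin : w₁ 1 = w₂ 0 := hw₁1.trans hw₂0.symm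
  obtain ⟨Λ₁, hL₁⟩ := hAdm₁.2
  obtain ⟨Λ₂, hL₂⟩ := hAdm₂.2
  refine ⟨concat w₁ w₂, ?_, concat_forall AnP hAn₁ hAn₂, ?_, ?_⟩
  · -- `Adm (concat w₁ w₂)`: the five pointwise conditions transfer branchwise; the log-Lipschitz
    -- clause holds with constant `2 (|Λ₁| + |Λ₂|)` (junction through `w₁ 1 = w₂ 0`).
    exact And.intro
      (concat_forall (fun v : G → ℝ => Continuous v ∧ (∀ g : G, 0 < v g) ∧
          (∀ g h : G, v (h * g * h⁻¹) = v g) ∧ (∀ g : G, v g⁻¹ = v g) ∧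
          (∀ (n : ℕ) (x : Fin n → G) (c : Fin n → ℂ),
            0 ≤ (∑ i, ∑ j, (starRingEnd ℂ) (c i) * c j * ((v ((x i)⁻¹ * x j) : ℝ) : ℂ)).re))
        hAdm₁.1 hAdm₂.1)
      ⟨2 * (|Λ₁| + |Λ₂|), concat_log_lipschitz hL₁ hL₂ hjoin⟩
  · rw [concat_zero]; exact hw₁0
  · rw [concat_one]; exact hw₂1

/-- The birth skeleton: the crux BY NAME modulo exactly the two registered stubs. -/
theorem AnalyticDetour_skeleton : AnalyticDetour :=
  AnalyticDetour_of stub_strongCouplingWindow stub_anchoredDetour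

end Summit.QuantumFields.YangMills.Cruxes.AnalyticDetour.Birth

end
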